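import Literature.Computability.Complexity.BoolEncodings
import HarnessLib

/-!
# Modular counting of zeros of a sparse polynomial over `𝔽₂` is in polynomial time for a fixed
# power of two (Wan 2008, Thm. 1.1; Gopalan–Guruswami–Lipton 2008)

Topic `Literature/Computability/Complexity`; for route `QuantumAdvantage/DyadicGap` (the bottom
`2`-adic digits of Toffoli+Hadamard path sums are classically computable).

Source: D. Wan, *Modular counting of rational points over finite fields*, Found. Comput. Math. 8
(2008) [Wan2007] (held text `paper:doi-10-1007-s10208-007-0245-y`, pp. 1–3), verbatim: "Let
`f(x₁,…,xₙ)` be a polynomial in `n` variables with coefficients in `𝔽_q` and with sparse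
representation. That is, `f` is written as a sum of `m` non-zero monomials
`f = Σ_{j=1}^m a_j x^{V_j}`, `a_j ∈ 𝔽_q^*`, `V_j ∈ ℤⁿ_{≥0}` … Let `N(f)` denote the number of
`𝔽_q`-rational points on the affine hypersurface defined by `f = 0`." **Theorem 1.1.** "Let
`f(x)` be a polynomial in `n` variables with `m` monomials over `𝔽_q`, where `q = p^h`. There is
a deterministic algorithm which computes `N_{p^b}(f)` [the reduction of `N(f)` modulo `p^b`] in
`O(n(8m)^{(h+b)p})` bit operations." (Earlier: P. Gopalan, V. Guruswami, R. Lipton,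
*Algorithms for modular counting of roots of multivariate polynomials*, Algorithmica 50 (2008)
[GopalanGuruswamiLipton2007], via modulus-amplifying polynomials, with NP-hardness for moduli
that are not powers of the characteristic.)

## What is vendored

The case `q = p = 2`, `h = 1` (time `O(n (8m)^{2(b+1)})`, polynomial in the input for FIXED `b`),
in the tree's machine vocabulary (`PolyTimeComputable` over Mathlib's `TM2` model with explicit
`{0,1}`-encodings, `BoolEncodings.lean`): for every fixed `b`, the map
`(n, f) ↦ N(f) mod 2^b` is polynomial-time computable, where a sparse polynomial over `𝔽₂` is a
list of monomials and a monomial is the list of (indices of) the variables occurring in it — over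
`𝔽₂` all coefficients are `1` and, as functions on `𝔽₂ⁿ`, `x^{V} = ∏_{i : V_i > 0} x_i`, so the
support of `V_j` is all that matters for `N(f)`. The number of variables `n` is given in UNARY
(`unaryEncodingNat`), matching the printed input model (there the `m` exponent vectors
`V_j ∈ ℤⁿ_{≥0}` are part of the input, so `|input| ≥ n` and `poly(n, m) = poly(|input|)`); with `n`
in binary the printed bound would not be polynomial in the input length without a further
(easy, but unprinted) reduction `N(f) = 2^{n-k} N_k(f)` to the `k` variables actually occurring.
"Bit operations" (RAM/boolean model) versus multitape/`TM2` steps is a polynomial overhead,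
immaterial for membership in `FP`; the fact is the printed theorem read at `p = 2, h = 1` through
this standard equivalence.

* `F2Sparse.eval mons y` — the value `f(y) ∈ 𝔽₂ = Bool` (parity of the number of monomials all of
  whose variables are `1` at `y`); `F2Sparse.countZeros n mons = N(f) = #{y ∈ 𝔽₂ⁿ : f(y) = 0}`.
* `Wan2008_countZerosModTwoPow_polyTime` — the named fact.
* API: `F2Sparse.eval_nil`, `F2Sparse.countZeros_nil` (`N(0) = 2ⁿ`), `F2Sparse.eval_cons`.

Deliberately NOT here: general `𝔽_q` (needs an encoding of `𝔽_{p^h}`-coefficients), the explicit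
operation count, the character-sum reformulation `Σ_y (−1)^{f(y)} = 2N(f) − 2ⁿ`, the GGL hardness
results, and the language form `{⟨f, r⟩ : N(f) ≡ r (mod 2^b)} ∈ P` (immediate from the `FP` form
with the tree's closure facts, left to the consumer).
-/

namespace Literature.Computability.Complexity

open _root_.Computability

/-- The value at `y : ℕ → Bool` (variable `i ↦ y i`) of the sparse `𝔽₂`-polynomial whose monomials
are the lists `mons` of variable indices: `f(y) = Σ_j ∏_{i ∈ M_j} y_i (mod 2)`, i.e. the parity of
the number of monomials all of whose variables are `true`. (Wan 2008, §1, sparse representation,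
read at `q = 2`.) [cite: Wan2007, §1 (sparse representation)] -/
def F2Sparse.eval (mons : List (List ℕ)) (y : ℕ → Bool) : Bool :=
  mons.foldr (fun M acc => xor (M.all y) acc) false

/-- `N(f) = #{y ∈ 𝔽₂ⁿ : f(y) = 0}`, the number of zeros in `𝔽₂ⁿ` of the sparse polynomial `mons` in
the variables `x₀, …, x_{n-1}` (variables of index `≥ n` are read as `0`, so a monomial
mentioning such an index vanishes identically; intended inputs mention only indices `< n`).
(Wan 2008, §1.) [cite: Wan2007, §1 (N(f))] -/
def F2Sparse.countZeros (n : ℕ) (mons : List (List ℕ)) : ℕ :=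
  (Finset.univ.filter fun y : Fin n → Bool =>
    F2Sparse.eval mons (fun i => if h : i < n then y ⟨i, h⟩ else false) = false).card

/-- The empty monomial list is the zero polynomial. [folklore] -/
@[simp] theorem F2Sparse.eval_nil (y : ℕ → Bool) : F2Sparse.eval [] y = false := rfl

/-- Unfolding `eval` on a cons: add (xor) the value of the first monomial. [folklore] -/
@[simp] theorem F2Sparse.eval_cons (M : List ℕ) (mons : List (List ℕ)) (y : ℕ → Bool) :
    F2Sparse.eval (M :: mons) y = xor (M.all y) (F2Sparse.eval mons y) := rfl

/-- The zero polynomial vanishes everywhere: `N(0) = 2ⁿ`. [folklore] -/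
theorem F2Sparse.countZeros_nil (n : ℕ) : F2Sparse.countZeros n [] = 2 ^ n := by
  simp [F2Sparse.countZeros, Fintype.card_bool, Fintype.card_fin]

/-- **Wan 2008, Theorem 1.1 at `q = p = 2`, `h = 1` (Gopalan–Guruswami–Lipton 2008 for prime-power
moduli of the characteristic): counting zeros of a sparse polynomial over `𝔽₂` modulo a FIXED power
of two is polynomial time.** For every `b : ℕ` the string function
`⟨n, f⟩ ↦ N(f) mod 2^b` — input a pair (number of variables `n` in UNARY, `1ⁿ`, Mathlib's
`unaryEncodingNat`, so that the input length is `≥ n` as in the printed input model where each of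
the `m` exponent vectors has `n` entries; list of monomials, each a list of variable indices in
binary; encodings of `BoolEncodings.lean`), output in binary — is computable in polynomial time
(`PolyTimeComputable`, the tree's `TM2` notion; printed bound `O(n(8m)^{2(b+1)})` bit operations,
polynomial in `n + (size of f) ≤ |input|`). Monomials are meant to mention only indices `< n`
(an index `≥ n` reads as the variable `0`, making that monomial vanish identically). [cite: Wan2007, Theorem 1.1 (q = p = 2, h = 1); GopalanGuruswamiLipton2007] -/
def Wan2008_countZerosModTwoPow_polyTime : Prop :=
  ∀ b : ℕ,
    PolyTimeComputable (unaryEncodingNat.pairBool encodingNatBool.listBool.listBool).encode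
      encodingNatBool.encode
      (fun p : ℕ × List (List ℕ) => F2Sparse.countZeros p.1 p.2 % 2 ^ b)

end Literature.Computability.Complexity
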